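import Literature.AlgebraicGeometry.Resolution.AffineBlowupAlgebra
import Literature.AlgebraicGeometry.Resolution.BlowupChartPair
import Literature.AlgebraicGeometry.Resolution.RegularLocalRingsQuotient
import Mathlib.RingTheory.LocalRing.ResidueField.Basic
import HarnessLib

/-!
# A contact jump is not passed by either order of the two lifts (crux `EquisingularLift`, honest variant
# EL♮ = `EquisingularLiftNat`, stmt-ResolutionOfSingularities-20038; idea card 1 `unscrew-split-orbits` rev. 2, step (c))

[OURS · L W4.5 (b)] Helper for the idea card 1 `unscrew-split-orbits` (rev. 2, the «uncolliding game») of `res-L1-w45b-idea-2`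
(`Cruxes/EquisingularLift/Ideas/`, Sketch `HOME/L/res-L1-w45b-idea-2/Sketch-L1-idea-2.lean` v5 l. 103, decl `JumpBlowupNotNormal`).
NOT a statement of the manuscript under review (Hironaka 2017); nothing here is attributed to its author. Pure commutative
algebra (independently found by res-L1-w45b-tri-1 TRIAGE v1 (a) and res-L1-w45b-tri-2 TRIAGE v1.1).

**Statement (verbatim the Sketch's `JumpBlowupNotNormal`).** `R` regular local of dimension `2` with `𝔪 = (z, ϖ)`;
`S = R[(z², ϖ²)/ϖ²] ⊆ R[1/ϖ²]` the `ϖ²`-chart of the blow-up of `(z², ϖ²)` (the tree's `blowupAlgebra`). Then there is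
`t ∈ R[1/ϖ²]` with `t ∉ S`, `t² ∈ S`, `t·ϖ = z`: the chart is not normal.

**Proof.** `ϖ` is a unit of `R[1/ϖ²]`; put `t := z·ϖ⁻¹`. Then `t·ϖ = z` and `t²·ϖ² = z²`, so `t² = z²/ϖ²` is a generator of
`S`. Since `dim R = 2 = μ(𝔪)`, `𝔪` is not principal; hence `ϖ ∉ 𝔪²` (Nakayama) — so `ϖ` is a prime element — and `ϖ ∤ z`.
Therefore `(ϖ², z²)` is a regular pair and `S ⊆ R[z²/ϖ²] ≅ R[X]/(ϖ²X − z²)` (tree `BlowupChartPair.ker_chartEval`,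
Stacks 0BIQ). If `t = P(z²/ϖ²)` with `P ∈ R[X]`, then `P² − X` lies in the kernel `(ϖ²X − z²)`, and reducing the
coefficients modulo `𝔪` gives `P̄² = X` in `k[X]`, absurd by degrees.
-/

set_option linter.dupNamespace false

noncomputable section

namespace Summit.ResolutionOfSingularities.ResolutionOfSingularities.Theorems.EquisingularLift.RamifiedCoalescence

open IsLocalRing Polynomial Literature.AlgebraicGeometry.Resolution

/-- In a regular local ring of dimension `2` whose maximal ideal is `(z, ϖ)`, the maximal ideal is not generated by
one element (`μ(𝔪) = dim R = 2`). OURS. -/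
theorem maximalIdeal_ne_span_singleton_of_dim_two {R : Type*} [CommRing R] [IsRegularLocalRing R]
    (hdim : ringKrullDim R = 2) (w : R) : maximalIdeal R ≠ Ideal.span {w} := by
  intro h
  have hreg := IsRegularLocalRing.spanFinrank_maximalIdeal (R := R)
  rw [hdim] at hreg
  have h2 : (maximalIdeal R).spanFinrank = 2 := by exact_mod_cast hreg
  have hle : (Ideal.span {w} : Ideal R).spanFinrank ≤ ({w} : Set R).ncard :=
    Submodule.spanFinrank_span_le_ncard_of_finite (Set.finite_singleton w)
  rw [Set.ncard_singleton, ← h, h2] at hle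
  omega

/-- Under the same hypotheses, `ϖ ∉ 𝔪²` (else `𝔪 = (z) + 𝔪²`, so `𝔪 = (z)` by Nakayama). OURS. -/
theorem varpi_not_mem_sq_of_dim_two {R : Type*} [CommRing R] [IsRegularLocalRing R] {z ϖ : R}
    (hm : maximalIdeal R = Ideal.span {z, ϖ}) (hdim : ringKrullDim R = 2) : ϖ ∉ maximalIdeal R ^ 2 := by
  intro hϖ2
  have hz : z ∈ maximalIdeal R := by rw [hm]; exact Ideal.subset_span (by simp)
  have hle : maximalIdeal R ≤ Ideal.span {z} ⊔ maximalIdeal R • maximalIdeal R := by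
    conv_lhs => rw [hm]
    rw [Ideal.span_insert]
    refine sup_le le_sup_left ?_
    rw [Ideal.span_singleton_le_iff_mem, Ideal.smul_eq_mul, ← pow_two]
    exact Ideal.mem_sup_right hϖ2
  have key : maximalIdeal R ≤ Ideal.span {z} :=
    Submodule.le_of_le_smul_of_le_jacobson_bot ((isNoetherian_def.mp inferInstance) _)
      (maximalIdeal_le_jacobson ⊥) hle
  have heq : maximalIdeal R = Ideal.span {z} :=
    le_antisymm key ((Ideal.span_singleton_le_iff_mem _).mpr hz)
  exact maximalIdeal_ne_span_singleton_of_dim_two hdim z heq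

/-- Under the same hypotheses, `ϖ ∤ z` (else `𝔪 = (ϖ)`). OURS. -/
theorem not_varpi_dvd_of_dim_two {R : Type*} [CommRing R] [IsRegularLocalRing R] {z ϖ : R}
    (hm : maximalIdeal R = Ideal.span {z, ϖ}) (hdim : ringKrullDim R = 2) : ¬ ϖ ∣ z := by
  intro hdvd
  apply maximalIdeal_ne_span_singleton_of_dim_two hdim ϖ
  rw [hm]
  apply le_antisymm
  · rw [Ideal.span_le]
    rintro x hx
    simp only [Set.mem_insert_iff, Set.mem_singleton_iff] at hx
    rcases hx with rfl | rfl
    · exact Ideal.mem_span_singleton.mpr hdvd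
    · exact Ideal.mem_span_singleton_self x
  · exact Ideal.span_mono (by simp)

/-- In `k[X]` over a field, `X` is not a square. OURS. -/
theorem X_ne_sq {k : Type*} [Field k] (P : k[X]) : P ^ 2 ≠ X := by
  intro h
  have hdeg := congrArg Polynomial.natDegree h
  rw [Polynomial.natDegree_pow, Polynomial.natDegree_X] at hdeg
  omega

/-- **Card 1 rev. 2, step (c) (Sketch `JumpBlowupNotNormal`, VERBATIM).** See the module docstring. OURS. -/
theorem JumpBlowupNotNormal :
  ∀ (R : Type) [CommRing R] [IsRegularLocalRing R] (z ϖ : R), maximalIdeal R = Ideal.span {z, ϖ} → ringKrullDim R = 2 →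
    let S := Literature.AlgebraicGeometry.Resolution.blowupAlgebra (Ideal.span {z ^ 2, ϖ ^ 2}) (ϖ ^ 2)
    ∃ t : Localization.Away (ϖ ^ 2), t ∉ S ∧ t ^ 2 ∈ S ∧
      t * algebraMap R (Localization.Away (ϖ ^ 2)) ϖ = algebraMap R (Localization.Away (ϖ ^ 2)) z := by
  intro R _ _ z ϖ hm hdim S
  haveI := isDomain_of_isRegularLocalRing R
  set L := Localization.Away (ϖ ^ 2) with hL
  -- arithmetic of `R`
  have hϖm : ϖ ∈ maximalIdeal R := by rw [hm]; exact Ideal.subset_span (by simp)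
  have hϖ2 : ϖ ∉ maximalIdeal R ^ 2 := varpi_not_mem_sq_of_dim_two hm hdim
  have hϖp : Prime ϖ := IsRegularLocalRing.prime_of_not_mem_sq hϖm hϖ2
  have hϖz : ¬ ϖ ∣ z := not_varpi_dvd_of_dim_two hm hdim
  have ha : ϖ ^ 2 ∈ nonZeroDivisors R := mem_nonZeroDivisors_of_ne_zero (pow_ne_zero 2 hϖp.ne_zero)
  have hb : ∀ r : R, ϖ ^ 2 ∣ r * z ^ 2 → ϖ ^ 2 ∣ r := by
    intro r hr
    have hz2 : ¬ ϖ ∣ z ^ 2 := fun h => hϖz (hϖp.dvd_of_dvd_pow h)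
    exact (hϖp.pow_dvd_of_dvd_mul_right 2 hz2) hr
  -- `ϖ` is a unit of `L = R[1/ϖ²]`
  have hu2 : IsUnit (algebraMap R L (ϖ ^ 2)) := IsLocalization.Away.algebraMap_isUnit (ϖ ^ 2)
  have hu : IsUnit (algebraMap R L ϖ) := by
    rw [map_pow] at hu2
    exact (isUnit_pow_iff two_ne_zero).mp hu2
  obtain ⟨u, hu'⟩ := hu
  -- `t := z · ϖ⁻¹`
  let t : L := algebraMap R L z * ↑u⁻¹
  have ht : t * algebraMap R L ϖ = algebraMap R L z := by
    simp only [t, ← hu', mul_assoc, Units.inv_mul, mul_one]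
  -- `t² = z²/ϖ²`, the generator of `S`
  have hgen : algebraMap R L (z ^ 2) * IsLocalization.Away.invSelf (ϖ ^ 2) ∈ S :=
    div_mem_blowupAlgebra _ _ (Ideal.subset_span (by simp))
  have ht2 : t ^ 2 = algebraMap R L (z ^ 2) * IsLocalization.Away.invSelf (ϖ ^ 2) := by
    have h1 : t ^ 2 * algebraMap R L (ϖ ^ 2) = algebraMap R L (z ^ 2) := by
      rw [map_pow, map_pow, ← mul_pow, ht]
    have h2 : algebraMap R L (z ^ 2) * IsLocalization.Away.invSelf (ϖ ^ 2) * algebraMap R L (ϖ ^ 2) =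
        algebraMap R L (z ^ 2) := div_mul_algebraMap _ _
    exact hu2.mul_left_injective (h1.trans h2.symm)
  -- the chart evaluation `R[X] → L`, `X ↦ z²/ϖ²`, and `S ⊆` its range
  have hX : BlowupChartPair.chartEval (ϖ ^ 2) (z ^ 2) X =
      algebraMap R L (z ^ 2) * IsLocalization.Away.invSelf (ϖ ^ 2) := by
    have h1 := BlowupChartPair.chartEval_X_mul_a (ϖ ^ 2) (z ^ 2)
    have h2 : algebraMap R L (z ^ 2) * IsLocalization.Away.invSelf (ϖ ^ 2) * algebraMap R L (ϖ ^ 2) =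
        algebraMap R L (z ^ 2) := div_mul_algebraMap _ _
    exact hu2.mul_left_injective (h1.trans h2.symm)
  have hS : S ≤ (BlowupChartPair.chartEval (ϖ ^ 2) (z ^ 2)).range := by
    refine Algebra.adjoin_le ?_
    rintro y ⟨x, hx, rfl⟩
    obtain ⟨r, s, hrs⟩ := Ideal.mem_span_pair.mp hx
    refine (AlgHom.mem_range _).mpr ⟨C r * X + C s, ?_⟩
    rw [map_add, map_mul, BlowupChartPair.chartEval_C, BlowupChartPair.chartEval_C, hX, ← hrs, map_add,
      map_mul, map_mul, add_mul]
    have h3 : algebraMap R L (ϖ ^ 2) * IsLocalization.Away.invSelf (ϖ ^ 2) = 1 := IsLocalization.Away.mul_invSelf _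
    rw [mul_assoc (algebraMap R L s), h3, mul_one, mul_assoc]
  refine ⟨t, ?_, ht2 ▸ hgen, ht⟩
  -- `t ∉ S`: otherwise `t = P(z²/ϖ²)`, `P² − X ∈ ker = (ϖ²X − z²)`, and `P̄² = X` over the residue field
  intro htS
  obtain ⟨P, hP⟩ := (AlgHom.mem_range _).mp (hS htS)
  have hker : P ^ 2 - X ∈ RingHom.ker (BlowupChartPair.chartEval (ϖ ^ 2) (z ^ 2)).toRingHom := by
    rw [RingHom.mem_ker]
    change BlowupChartPair.chartEval (ϖ ^ 2) (z ^ 2) (P ^ 2 - X) = 0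
    rw [map_sub, map_pow, hP, hX, ← ht2, sub_self]
  rw [BlowupChartPair.ker_chartEval _ _ ha hb, Ideal.mem_span_singleton] at hker
  obtain ⟨Q, hQ⟩ := hker
  have hred := congrArg (Polynomial.map (IsLocalRing.residue R)) hQ
  have hϖ0 : IsLocalRing.residue R (ϖ ^ 2) = 0 := by
    rw [map_pow, (IsLocalRing.residue_eq_zero_iff ϖ).mpr hϖm, zero_pow two_ne_zero]
  have hz0 : IsLocalRing.residue R (z ^ 2) = 0 := by
    have hz : z ∈ maximalIdeal R := by rw [hm]; exact Ideal.subset_span (by simp)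
    rw [map_pow, (IsLocalRing.residue_eq_zero_iff z).mpr hz, zero_pow two_ne_zero]
  rw [Polynomial.map_sub, Polynomial.map_pow, Polynomial.map_X, Polynomial.map_mul, Polynomial.map_sub,
    Polynomial.map_mul, Polynomial.map_C, Polynomial.map_C, Polynomial.map_X, hϖ0, hz0, map_zero, zero_mul,
    sub_zero, zero_mul, sub_eq_zero] at hred
  exact X_ne_sq _ hred

end Summit.ResolutionOfSingularities.ResolutionOfSingularities.Theorems.EquisingularLift.RamifiedCoalescence
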